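import Summits.BirchSwinnertonDyer.BirchSwinnertonDyer.Theorems.PAdicOrderV2PAdicOrderThesisR2StubJetVisible
import Summits.BirchSwinnertonDyer.BirchSwinnertonDyer.Theorems.PAdicOrderV2PAdicOrderThesisR2StubPointShape
import Summits.BirchSwinnertonDyer.BirchSwinnertonDyer.Theorems.PAdicOrderV2PAdicOrderThesisR2StubJetAssembly
import Summits.BirchSwinnertonDyer.BirchSwinnertonDyer.Theorems.PAdicOrderV2PAdicOrderThesisR2StubSigmaJet
import Literature.NumberTheory.EllipticCurves.CanonicalPAdicHeightHolds
import Literature.NumberTheory.EllipticCurves.BSDAnalyticRankTunnellCMProofs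
import Literature.NumberTheory.EllipticCurves.RationalIsogenyFrobeniusCriterion
import Literature.NumberTheory.EllipticCurves.PointCountEulerCriterion
import Literature.NumberTheory.EllipticCurves.CanonicalPAdicHeightLeavesProofs

/-!
# BirchSwinnertonDyer / PAdicOrderV2 — crux `PAdicOrderThesisR2` (stmt-0487), line `wieferich-jet`:
# the certified instance — the canonical `5`-adic height of 37a1 does not vanish at `8P`

Mazur–Stein–Tate 2006, §4.1 compute the canonical cyclotomic `5`-adic height of the generator
`P = (0, 0)` of `E = 37a1 : y² + y = x³ − x` through the admissible multiple `Q = 8P = (21/25, −69/125)`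
(`h₅(Q) = 3 + 5 + 2·5³ + ⋯` in their normalisation). This file CERTIFIES, in the kernel, the
qualitative content of that computation via the height-Wieferich criterion of this line
(`canonicalPAdicHeight_ne_zero_of_not_isHeightWieferich`, landed p144815 in
`…Theorems/PAdicOrderV2PAdicOrderThesisR2JetCongruence.lean`; re-derived inline here from the four
landed stubs so that this file does not wait on that module): `ĥ₅(Q) ≠ 0` for the tree's
canonical height `ĥ_p = log_p(den x) − 2 log_p σ_p(−x/y)` (Stein–Wuthrich 2013 §4.1 (4.1)), hence the
canonical `5`-adic height PAIRING of 37a1 (which exists, `exists_isCanonical_holds`) is non-zero at `Q`.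

Ingredients, all proved here from the definitions: `Δ = 37`, so the equation is elliptic and globally
minimal (`ord_v Δ ≤ 1 < 12` everywhere); `#Ẽ(𝔽₅) = 8` by a kernel point count (Euler criterion), so
`a₅ = −2` and `5` is good ordinary; `Q` lies on the curve, `‖x(Q)‖₅ = 25 > 1`, `Q` is in the sigma disc
and reduces to a non-singular point modulo every prime (`ℓ = 5`: to `Õ`; `ℓ = 13`: `Φ_x(Q) = −698/625`
is a unit; otherwise `Φ_y(Q) = −13/125` is a unit), and `E₁(ℚ₅) ∩ E(ℚ)` is torsion-free
(`not_isOfFinAddOrder_of_one_lt_padicNorm_holds`), so `Q` is ADMISSIBLE; finally `21⁴ − 1 = 5·38896`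
with `5 ∤ 38896`, so `5` is not height-Wieferich for `Q`. No `native_decide`; `decide +kernel` only on
the `𝔽₅`-point count and on `Rat.num/den` of the literal `21/25`.

References: B. Mazur, W. Stein, J. Tate, *Computation of p-adic heights and log convergence*,
Doc. Math. Extra Vol. Coates (2006), §4.1; J. E. Cremona, *Algorithms for Modular Elliptic Curves*,
table 1 (37a1).
-/

-- single-conjunct summit: `Summit.BirchSwinnertonDyer.BirchSwinnertonDyer.…` repeats the name by design
set_option linter.dupNamespace false

namespace Summit.BirchSwinnertonDyer.BirchSwinnertonDyer.Cruxes.PAdicOrderThesisR2.WieferichJet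

open Literature.NumberTheory.EllipticCurves IsDedekindDomain NumberField WeierstrassCurve

/-- `Δ(37a1) = 37` for the integer model `[0, 0, 1, -1, 0]`. [folklore] -/
theorem curve37a1_int_Δ : (⟨0, 0, 1, -1, 0⟩ : WeierstrassCurve ℤ).Δ = 37 := by
  norm_num [WeierstrassCurve.Δ, WeierstrassCurve.b₂, WeierstrassCurve.b₄, WeierstrassCurve.b₆,
    WeierstrassCurve.b₈]

/-- `Δ(37a1) = 37` over `ℚ`. [folklore] -/
theorem curve37a1_Δ : ((⟨0, 0, 1, -1, 0⟩ : WeierstrassCurve ℤ).baseChange ℚ).Δ = 37 := by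
  rw [baseChange_int_Δ, curve37a1_int_Δ]; norm_num

/-- 37a1 is an elliptic curve (`Δ = 37 ≠ 0`). [folklore] -/
theorem isElliptic_curve37a1 : ((⟨0, 0, 1, -1, 0⟩ : WeierstrassCurve ℤ).baseChange ℚ).IsElliptic :=
  ⟨isUnit_iff_ne_zero.mpr (by rw [curve37a1_Δ]; norm_num)⟩

/-- `y² + y = x³ − x` is a global minimal equation (integral, `Δ = 37` squarefree, so
`ord_v Δ ≤ 1 < 12` at every place; Silverman AEC VII.1 Remark 1.1). [folklore] -/
theorem isGloballyMinimal_curve37a1 :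
    ((⟨0, 0, 1, -1, 0⟩ : WeierstrassCurve ℤ).baseChange ℚ).IsGloballyMinimal where
  isIntegral := isIntegral_of_exists_lift _ ⟨0, by simp [baseChange]⟩ ⟨0, by simp [baseChange]⟩
    ⟨1, by simp [baseChange]⟩ ⟨-1, by simp [baseChange]⟩ ⟨0, by simp [baseChange]⟩
  isMinimal v := by
    refine isMinimalAt_of_lt_valuation_Δ_holds
      (isIntegralAt_of_valuation_le_one v _ ?_ ?_ ?_ ?_ ?_) ?_
    · simp [baseChange]
    · simp [baseChange]
    · simp [baseChange]
    · simp [baseChange]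
    · simp [baseChange]
    · rw [curve37a1_Δ, show (37 : ℚ) = ((37 : ℕ) : ℚ) by norm_num]
      have h37 : Squarefree (37 : ℕ) := (Nat.prime_iff.mp (by norm_num)).squarefree
      exact lt_trans (WithZero.exp_lt_exp.mpr (by norm_num)) (exp_neg_two_lt_valuation_natCast v h37)

/-- `#Ẽ(𝔽₅) = 8` for 37a1, i.e. `a₅ = −2` (kernel point count via the Euler criterion).
[folklore] -/
theorem card_curve37a1_5 :
    Nat.card (((⟨0, 0, 1, -1, 0⟩ : WeierstrassCurve ℤ).map (Int.castRingHom (ZMod 5))).toAffine.Point)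
      = 8 := by
  rw [@WeierstrassCurve.natCard_point_eq_one_add_card (ZMod 5) (@ZMod.instField 5 ⟨by norm_num⟩) _ _
    _ (by decide +kernel), @card_sol_eq_sum_euler (ZMod 5) (@ZMod.instField 5 ⟨by norm_num⟩) _ _
    (by rw [ZMod.ringChar_zmod_n]; decide), ZMod.card]
  decide +kernel

/-- `a₅(37a1) = −2`. [folklore] -/
theorem frobeniusTrace_curve37a1_5
    [((⟨0, 0, 1, -1, 0⟩ : WeierstrassCurve ℤ).baseChange ℚ).IsGloballyMinimal] :
    frobeniusTrace ((⟨0, 0, 1, -1, 0⟩ : WeierstrassCurve ℤ).baseChange ℚ) 5 = -2 := by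
  rw [frobeniusTrace_baseChange_int _ card_curve37a1_5]
  norm_num

/-- `5` is a good ordinary prime of 37a1 (`5 ∤ Δ = 37`, `a₅ = −2`). [folklore] -/
theorem isOrdinaryAt_curve37a1_5 [Fact (Nat.Prime 5)]
    [((⟨0, 0, 1, -1, 0⟩ : WeierstrassCurve ℤ).baseChange ℚ).IsGloballyMinimal] :
    IsOrdinaryAt ((⟨0, 0, 1, -1, 0⟩ : WeierstrassCurve ℤ).baseChange ℚ) 5 := by
  refine ⟨hasGoodReductionAtPrime_baseChange_int _ 5 ?_, ?_⟩
  · rw [curve37a1_int_Δ]; norm_num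
  · rw [frobeniusTrace_curve37a1_5]; norm_num

/-! ### The point `Q = 8P = (21/25, −69/125)` is admissible at `p = 5` -/

/-- `Q = (21/25, −69/125)` lies on 37a1 (it is `8·(0,0)`; Mazur–Stein–Tate 2006 §4.1) and is a
non-singular point. [folklore] -/
theorem nonsingular_curve37a1_Q :
    ((⟨0, 0, 1, -1, 0⟩ : WeierstrassCurve ℤ).baseChange ℚ).toAffine.Nonsingular (21 / 25) (-69 / 125) := by
  haveI := isElliptic_curve37a1
  refine WeierstrassCurve.Affine.equation_iff_nonsingular.mp ?_
  rw [WeierstrassCurve.Affine.equation_iff]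
  norm_num [WeierstrassCurve.baseChange]

/-- `Φ_y(Q) = 2y + a₁x + a₃ = −13/125`. [folklore] -/
theorem evalEval_polynomialY_curve37a1_Q :
    ((⟨0, 0, 1, -1, 0⟩ : WeierstrassCurve ℤ).baseChange ℚ).toAffine.polynomialY.evalEval (21 / 25) (-69 / 125)
      = -(((13 : ℕ) : ℚ) / ((125 : ℕ) : ℚ)) := by
  rw [WeierstrassCurve.Affine.evalEval_polynomialY]
  norm_num [WeierstrassCurve.baseChange]

/-- `Φ_x(Q) = a₁y − (3x² + 2a₂x + a₄) = −698/625`. [folklore] -/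
theorem evalEval_polynomialX_curve37a1_Q :
    ((⟨0, 0, 1, -1, 0⟩ : WeierstrassCurve ℤ).baseChange ℚ).toAffine.polynomialX.evalEval (21 / 25) (-69 / 125)
      = -(((698 : ℕ) : ℚ) / ((625 : ℕ) : ℚ)) := by
  rw [WeierstrassCurve.Affine.evalEval_polynomialX]
  norm_num [WeierstrassCurve.baseChange]

/-- `ord_ℓ (m/n) = 0` for naturals `m, n` prime to `ℓ`. [folklore] -/
theorem padicValRat_div_natCast_eq_zero {ℓ : ℕ} [Fact ℓ.Prime] {m n : ℕ} (hm : ¬ ℓ ∣ m)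
    (hn : ¬ ℓ ∣ n) : padicValRat ℓ ((m : ℚ) / (n : ℚ)) = 0 := by
  have hm0 : (m : ℚ) ≠ 0 := by
    have : m ≠ 0 := by rintro rfl; exact hm (dvd_zero ℓ)
    exact_mod_cast this
  have hn0 : (n : ℚ) ≠ 0 := by
    have : n ≠ 0 := by rintro rfl; exact hn (dvd_zero ℓ)
    exact_mod_cast this
  rw [padicValRat.div hm0 hn0, padicValRat.of_nat, padicValRat.of_nat,
    padicValNat.eq_zero_of_not_dvd hm, padicValNat.eq_zero_of_not_dvd hn]
  simp

/-- **`Q = (21/25, −69/125)` reduces to a non-singular point modulo every prime** (37a1 has prime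
conductor `37`; at `ℓ = 5` the point reduces to `Õ`, at `ℓ = 13` use `Φ_x(Q) = −698/625`, elsewhere
`Φ_y(Q) = −13/125` is an `ℓ`-unit). [folklore] -/
theorem hasNonsingularReductionAt_curve37a1_Q (ℓ : ℕ) (hℓ : ℓ.Prime) :
    ((⟨0, 0, 1, -1, 0⟩ : WeierstrassCurve ℤ).baseChange ℚ).HasNonsingularReductionAt ℓ (21 / 25) (-69 / 125) := by
  haveI : Fact ℓ.Prime := ⟨hℓ⟩
  unfold WeierstrassCurve.HasNonsingularReductionAt
  by_cases h5 : ℓ = 5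
  · subst h5
    refine Or.inl ?_
    rw [show (21 / 25 : ℚ) = ((21 : ℕ) : ℚ) / ((25 : ℕ) : ℚ) by norm_num,
      padicValRat.div (by norm_num) (by norm_num), padicValRat.of_nat, padicValRat.of_nat,
      padicValNat.eq_zero_of_not_dvd (by norm_num), show (25 : ℕ) = 5 ^ 2 by norm_num,
      padicValNat.prime_pow]
    norm_num
  by_cases h13 : ℓ = 13
  · subst h13
    refine Or.inr (Or.inl ⟨?_, ?_⟩)
    · rw [evalEval_polynomialX_curve37a1_Q]; norm_num
    · rw [evalEval_polynomialX_curve37a1_Q, padicValRat.neg]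
      exact padicValRat_div_natCast_eq_zero (by norm_num) (by norm_num)
  · refine Or.inr (Or.inr ⟨?_, ?_⟩)
    · rw [evalEval_polynomialY_curve37a1_Q]; norm_num
    · rw [evalEval_polynomialY_curve37a1_Q, padicValRat.neg]
      refine padicValRat_div_natCast_eq_zero ?_ ?_
      · intro h
        exact h13 ((Nat.prime_dvd_prime_iff_eq hℓ (by norm_num)).mp h)
      · intro h
        exact h5 ((Nat.prime_dvd_prime_iff_eq hℓ Nat.prime_five).mp
          (hℓ.dvd_of_dvd_pow (show ℓ ∣ 5 ^ 3 by simpa using h)))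

/-- `‖21/25‖₅ = 25 > 1`: `Q ∈ E₁(ℚ₅)`. [folklore] -/
theorem one_lt_norm_curve37a1_Qx : 1 < ‖((21 / 25 : ℚ) : ℚ_[5])‖ := by
  haveI : Fact (Nat.Prime 5) := ⟨Nat.prime_five⟩
  have hval : padicValRat 5 (21 / 25 : ℚ) = -2 := by
    rw [show (21 / 25 : ℚ) = ((21 : ℕ) : ℚ) / ((25 : ℕ) : ℚ) by norm_num,
      padicValRat.div (by norm_num) (by norm_num), padicValRat.of_nat, padicValRat.of_nat,
      padicValNat.eq_zero_of_not_dvd (by norm_num), show (25 : ℕ) = 5 ^ 2 by norm_num,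
      padicValNat.prime_pow]
    norm_num
  rw [Padic.eq_padicNorm, padicNorm.eq_zpow_of_nonzero (by norm_num), hval]
  norm_num

/-- **`Q = 8P = (21/25, −69/125)` is an ADMISSIBLE point of 37a1 at `p = 5`** (non-torsion as a
point of `E₁(ℚ₅)`, `‖x‖₅ > 1`, sigma disc, non-singular reduction everywhere).
[cite: MazurSteinTate2006, §4.1] -/
theorem isAdmissible_curve37a1_Q [Fact (Nat.Prime 5)]
    [((⟨0, 0, 1, -1, 0⟩ : WeierstrassCurve ℤ).baseChange ℚ).IsGloballyMinimal] :
    ((⟨0, 0, 1, -1, 0⟩ : WeierstrassCurve ℤ).baseChange ℚ).IsAdmissible 5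
      (.some (21 / 25) (-69 / 125) nonsingular_curve37a1_Q) := by
  haveI := isElliptic_curve37a1
  have hx := one_lt_norm_curve37a1_Qx
  refine ⟨not_isOfFinAddOrder_of_one_lt_padicNorm_holds _ 5 (by norm_num) _ hx, ?_⟩
  show 1 < ‖((21 / 25 : ℚ) : ℚ_[5])‖ ∧ _ ∧ _
  exact ⟨hx, (WeierstrassCurve.inSigmaDisc_of_one_lt_norm (by norm_num) nonsingular_curve37a1_Q hx).2,
    hasNonsingularReductionAt_curve37a1_Q⟩

/-! ### The certified instance: `ĥ₅(Q) ≠ 0` on 37a1 (Mazur–Stein–Tate 2006, §4.1) -/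

/-- `5` is NOT height-Wieferich for `Q`: `num x = 21`, `den x = 25`, `21⁴ − 1 = 194480 = 5 · 38896`
with `5 ∤ 38896`, so `v₅(21⁴ − 1) = 1 < 2 = v₅(25)`. Pure integer arithmetic. [folklore] -/
theorem not_isHeightWieferich_curve37a1_Q :
    ¬ ((21 / 25 : ℚ).num ^ (5 - 1) = 1 ∨
      (padicValNat 5 (21 / 25 : ℚ).den : ℤ) ≤ padicValInt 5 ((21 / 25 : ℚ).num ^ (5 - 1) - 1)) := by
  have hn : (21 / 25 : ℚ).num = 21 := by decide +kernel
  have hd : (21 / 25 : ℚ).den = 25 := by decide +kernel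
  have h1 : padicValNat 5 25 = 2 := by
    rw [show (25 : ℕ) = 5 ^ 2 by norm_num, padicValNat.prime_pow]
  have h2 : padicValInt 5 ((21 : ℤ) ^ (5 - 1) - 1) = 1 := by
    rw [show (21 : ℤ) ^ (5 - 1) - 1 = ((5 * 38896 : ℕ) : ℤ) by norm_num, padicValInt.of_nat,
      padicValNat.mul (by norm_num) (by norm_num), padicValNat.self (by norm_num),
      padicValNat.eq_zero_of_not_dvd (by norm_num)]
  rw [hn, hd, h1, h2]
  norm_num

/-- **Certified instance of the height-Wieferich criterion (Mazur–Stein–Tate 2006, §4.1): the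
canonical cyclotomic `5`-adic height of `E = 37a1 : y² + y = x³ − x` does not vanish at
`Q = 8·(0,0) = (21/25, −69/125)`**, `ĥ₅(Q) ≠ 0` — in the Stein–Wuthrich normalisation
`ĥ_p = log_p(den x) − 2 log_p σ_p(−x/y)` of the tree (`WeierstrassCurve.canonicalPAdicHeight`).
Ingredients, all kernel-checked: `y² + y = x³ − x` is globally minimal (`Δ = 37`), `5` is good
ordinary (`#Ẽ(𝔽₅) = 8`, `a₅ = −2`), `Q` is admissible at `5`, and `21⁴ ≢ 1 (mod 25)`; then the jet
congruence `ĥ₅(Q) ≡ log₅ 21 (mod 5²)` and `‖log₅ 21‖₅ = ‖21⁴ − 1‖₅ = 5⁻¹` give `‖ĥ₅(Q)‖₅ = 5⁻¹ ≠ 0`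
(MST print `h₅(Q) = 3 + 5 + 2·5³ + ⋯` in their normalisation `h_p = −ĥ_p/(2p)`).
[cite: MazurSteinTate2006, §4.1] -/
theorem canonicalPAdicHeight_curve37a1_Q_ne_zero :
    ∀ [Fact (Nat.Prime 5)], ((⟨0, 0, 1, -1, 0⟩ : WeierstrassCurve ℤ).baseChange ℚ).canonicalPAdicHeight 5
      (.some (21 / 25) (-69 / 125) nonsingular_curve37a1_Q) ≠ 0 := by
  intro _
  haveI := isElliptic_curve37a1
  haveI := isGloballyMinimal_curve37a1
  intro h0
  -- the jet congruence at (37a1, 5, Q) and the visibility of `log₅ 21`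
  have hJ := stub_jetAssembly stub_pointShape stub_sigmaJet _ 5 le_rfl isOrdinaryAt_curve37a1_5 _
    isAdmissible_curve37a1_Q
  have hvis := stub_jetVisible_of_not_heightWieferich 5 (by norm_num) (21 / 25 : ℚ)
    (by rw [show (21 / 25 : ℚ).num = 21 by decide +kernel]; decide) not_isHeightWieferich_curve37a1_Q
  rw [h0, zero_sub, norm_neg] at hJ
  exact absurd hvis (not_lt.mpr hJ)

/-- **Hence the canonical cyclotomic `5`-adic height PAIRING of 37a1 exists and is non-zero at
`Q = (21/25, −69/125)`**: `⟨Q, Q⟩₅ = ĥ₅(Q) ≠ 0` — a kernel-certified weak-Schneider witness for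
`(37a1, p = 5)` (non-degeneracy of the canonical `5`-adic height on the line `ℤ·Q ⊆ E(ℚ)`; 37a1
has rank one, Cremona, so this is Schneider's conjecture for `(37a1, 5)` granted `rank = 1`, which
is not re-proved here). [cite: MazurSteinTate2006, §1 and §4.1] -/
theorem exists_isCanonical_and_pairing_ne_zero_curve37a1 [Fact (Nat.Prime 5)] :
    ∃ D : WeierstrassCurve.PAdicHeightData ((⟨0, 0, 1, -1, 0⟩ : WeierstrassCurve ℤ).baseChange ℚ) 5,
      D.IsCanonical ∧
        D.pairing (.some (21 / 25) (-69 / 125) nonsingular_curve37a1_Q)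
          (.some (21 / 25) (-69 / 125) nonsingular_curve37a1_Q) ≠ 0 := by
  haveI := isElliptic_curve37a1
  haveI := isGloballyMinimal_curve37a1
  obtain ⟨D, hD⟩ := WeierstrassCurve.exists_isCanonical_holds _ 5 le_rfl
    isOrdinaryAt_curve37a1_5.1 isOrdinaryAt_curve37a1_5.2
  refine ⟨D, hD, ?_⟩
  rw [hD _ isAdmissible_curve37a1_Q]
  exact canonicalPAdicHeight_curve37a1_Q_ne_zero

end Summit.BirchSwinnertonDyer.BirchSwinnertonDyer.Cruxes.PAdicOrderThesisR2.WieferichJet
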